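import Summits.CriticalPhenomena.SAWScalingLimit.Theorems.SAWDevelopingMapObservableToSLETypeLadderCarvedReductionSqueezeReachDisc
import Summits.CriticalPhenomena.SAWScalingLimit.Theorems.SAWDevelopingMapObservableToSLETypeLadderCarvedReductionSqueezeWalkOffZones
import HarnessLib

/-!
# The reach clause (R) for the framed super-domain, eventually and uniformly over all
# removed-set-avoiding walks from the gate (piece (T-A′ P4) of stub T-A′
# `stub_carvedReduction_squeezeGeometry_domains`)

Crux `SAWDevelopingMap.ObservableToSLE` (stmt-CriticalPhenomena-10472), line `six-class-type-ladder`,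
stub T-A′ `stub_carvedReduction_squeezeGeometry_domains`.  Landing target:
`Summits/CriticalPhenomena/SAWScalingLimit/Theorems/SAWDevelopingMapObservableToSLETypeLadderCarvedReductionSqueezeReachSup.lean`
(`--supports stmt-CriticalPhenomena-10472`; registered carrier `stub_carvedReduction_reachSup`).
Composition of `stub_carvedReduction_walkOffZones` (p144234; its conclusion is taken VERBATIM as a
hypothesis, at `κ = 60`) and `stub_carvedReduction_reachDisc` (p144659).

Clause (R) of STAGE 2 for `E = E^sup` (`stub_carvedReduction_superFrame`: every point joined to
the bulk point `b₀` inside `J` off the cuts lies in `E`): eventually in `j`, for every walk `π` of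
`D_{s_j}` from the gate vertex `q_j` avoiding `U_j` and every vertex `y` of `π`, the pinned centre
`ỹ` lies in `E` and `closedBall ỹ (25 s_j) ⊆ E ∪ ⋃ᵢ slabᵢ`.  Inputs: the `JoinedIn`
characterisation, the cuts inside `J` lie in the far obstacles (exit zones, body zones) or the
near ones (frame rectangles, deep low boxes), the uniform avoidance of `…WalkOffZones`, the initial
segment `JoinedIn (J ∖ cuts) q̃_j b₀` (eventually), present vertices of the windows strictly above
the gate lines (eventually), and the bookkeeping inequalities.  (The rows clause of (R) is the
window exactness of STAGE 1a and is not repeated here.)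
-/

noncomputable section

open scoped Topology
open Filter Set Metric
open Literature.Probability.LatticeModels (HexVertex hexGraph hexCenter triEmbed Site)
open Literature.Probability.RandomPlanarGeometry
open Literature.Probability.RandomPlanarGeometry.SAW

namespace Summit.CriticalPhenomena.SAWScalingLimit.Theorems.ObservableToSLE.TypeLadder

/-- **Registered carrier `stub_carvedReduction_reachSup`** (crux item stmt-CriticalPhenomena-10472,
stub T-A′ `stub_carvedReduction_squeezeGeometry_domains`, piece THE REACH CLAUSE FOR THE
SUPER-DOMAIN); see the module docstring. -/
theorem stub_carvedReduction_reachSup :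
    ∀ (Ω J E Cut Fset : Set ℂ) (b₀ : ℂ) (P : Fin 2 → ℂ) (B : Fin 2 → Set ℂ) (r : Fin 2 → ℝ)
      (s : ℕ → ℝ) (x : ℕ → Site 2) (U : ℕ → Set HexVertex) (q : ℕ → HexVertex) (ρc h R₁ μ : ℝ),
      (∀ j, 0 < s j) → Tendsto s atTop (𝓝 0) → 0 < ρc → 0 < h → 0 < μ → ρc + h + μ < R₁ → 2 * R₁ < dist (P 0) (P 1) →
      (∀ z : ℂ, JoinedIn (J \ Cut) z b₀ → z ∈ E) →
      Cut ∩ J ⊆ (Fset ∪ ⋃ i, {z : ℂ | infDist z (B i) < r i}) ∪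
        ⋃ i, ({z : ℂ | |z.re - (P i).re| ≤ ρc ∧ (P i).im - h ≤ z.im ∧ z.im ≤ (P i).im} ∪
          ({z : ℂ | z.im < (P i).im - h} ∩ ball (P i) (R₁ - μ))) →
      (∀ j, (s j : ℂ) * hexCenter (q j) ∈ closure Ω) →
      (∀ᶠ j in atTop, ∀ (a b : HexVertex) (w : (hexDomainGraph Ω (s j)).Walk a b),
        (∀ y ∈ w.support, y ∉ U j) → (s j : ℂ) * hexCenter a ∈ closure Ω →
        (∀ y ∈ w.support, ∀ p : ℂ, dist p ((s j : ℂ) * hexCenter y - (s j : ℂ) * triEmbed (x j)) ≤ 60 * s j →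
          p ∈ J ∧ p ∉ Fset ∧ ∀ i, r i ≤ infDist p (B i)) ∧
        (∀ y ∈ w.support, (s j : ℂ) * hexCenter y - (s j : ℂ) * triEmbed (x j) ∈
          J \ (Fset ∪ (⋃ i, {z : ℂ | infDist z (B i) < r i}) ∪
            ⋃ i, ({z : ℂ | z.im ≤ (P i).im} ∩ closedBall (P i) (R₁ - μ)))) ∧
        (∀ y ∈ w.support, ∀ y' ∈ w.support, (hexDomainGraph Ω (s j)).Adj y y' →
          segment ℝ ((s j : ℂ) * hexCenter y - (s j : ℂ) * triEmbed (x j))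
              ((s j : ℂ) * hexCenter y' - (s j : ℂ) * triEmbed (x j)) ⊆
            J \ (Fset ∪ (⋃ i, {z : ℂ | infDist z (B i) < r i}) ∪
              ⋃ i, ({z : ℂ | z.im ≤ (P i).im} ∩ closedBall (P i) (R₁ - μ)))) ∧
        JoinedIn (J \ (Fset ∪ (⋃ i, {z : ℂ | infDist z (B i) < r i}) ∪
            ⋃ i, ({z : ℂ | z.im ≤ (P i).im} ∩ closedBall (P i) (R₁ - μ))))
          ((s j : ℂ) * hexCenter a - (s j : ℂ) * triEmbed (x j)) ((s j : ℂ) * hexCenter b - (s j : ℂ) * triEmbed (x j))) →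
      (∀ᶠ j in atTop, JoinedIn (J \ Cut) ((s j : ℂ) * hexCenter (q j) - (s j : ℂ) * triEmbed (x j)) b₀) →
      (∀ i, ∀ᶠ j in atTop, ∀ v : HexVertex, (s j : ℂ) * hexCenter v - (s j : ℂ) * triEmbed (x j) ∈ ball (P i) R₁ →
        v ∉ U j → (P i).im < ((s j : ℂ) * hexCenter v - (s j : ℂ) * triEmbed (x j)).im) →
      ∀ᶠ j in atTop, ∀ (wv : HexVertex) (π : (hexDomainGraph Ω (s j)).Walk (q j) wv),
        (∀ y ∈ π.support, y ∉ U j) → ∀ y ∈ π.support,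
          (s j : ℂ) * hexCenter y - (s j : ℂ) * triEmbed (x j) ∈ E ∧
          closedBall ((s j : ℂ) * hexCenter y - (s j : ℂ) * triEmbed (x j)) (25 * s j) ⊆
            E ∪ ⋃ i, {z : ℂ | |z.re - (P i).re| ≤ ρc ∧ (P i).im - 30 * s j ≤ z.im ∧ z.im ≤ (P i).im} := by
  intro Ω J E Cut Fset b₀ P B r s x U q ρc h R₁ μ hs hs0 hρc hh hμ hR₁ hsep hjoinE hCut hqΩ hwalk hstart habove
  -- eventual smallness of the mesh
  have e1 : ∀ᶠ j in atTop, 60 * s j < min (min (h / 25 * 60) (μ / 50 * 60)) (dist (P 0) (P 1) - 2 * R₁) := by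
    have : Tendsto (fun j => 60 * s j) atTop (𝓝 (60 * 0)) := hs0.const_mul 60
    rw [mul_zero] at this
    exact this.eventually (gt_mem_nhds (lt_min (lt_min (by positivity) (by positivity)) (by linarith)))
  filter_upwards [hwalk, hstart, eventually_all.2 habove, e1] with j hjw hjs hja hje wv π hπ y hy
  have hsj := hs j
  have h25 : 25 * s j < h := by
    have := (hje.trans_le (min_le_left _ _)).trans_le (min_le_left _ _); nlinarith
  have h50 : 50 * s j < μ := by
    have := (hje.trans_le (min_le_left _ _)).trans_le (min_le_right _ _); nlinarith
  have hsep' : 2 * R₁ + 60 * s j ≤ dist (P 0) (P 1) := by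
    have := hje.trans_le (min_le_right _ _); linarith
  -- notation
  set τj : ℂ := (s j : ℂ) * triEmbed (x j) with hτj
  set X : Set ℂ := Fset ∪ (⋃ i, {z : ℂ | infDist z (B i) < r i}) ∪
    ⋃ i, ({z : ℂ | z.im ≤ (P i).im} ∩ closedBall (P i) (R₁ - μ)) with hX
  set Y : Set ℂ := Fset ∪ ⋃ i, {z : ℂ | infDist z (B i) < r i} with hY
  -- the sub-walk from the gate to `y`
  set π' := π.takeUntil y hy with hπ'
  have hπ'U : ∀ v ∈ π'.support, v ∉ U j := fun v hv => hπ v (π.support_takeUntil_subset_support hy hv)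
  obtain ⟨hpt, -, -, hjoin⟩ := hjw (q j) y π' hπ'U (hqΩ j)
  have hyend : y ∈ π'.support := π'.end_mem_support
  -- `J ∖ X ⊆ J ∖ Cut`: the cuts inside `J` lie in `X`
  have hXCut : J \ X ⊆ J \ Cut := by
    rintro z ⟨hzJ, hzX⟩
    refine ⟨hzJ, fun hzC => hzX ?_⟩
    rcases hCut ⟨hzC, hzJ⟩ with hz | hz
    · exact Or.inl hz
    · obtain ⟨i, hi⟩ := mem_iUnion.1 hz
      refine Or.inr (mem_iUnion.2 ⟨i, ?_⟩)
      rcases hi with ⟨hre, him1, him2⟩ | ⟨him, hball⟩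
      · refine ⟨show z.im ≤ (P i).im from him2, mem_closedBall.2 ?_⟩
        refine (dist_le_abs_re_add_abs_im z (P i)).trans ?_
        rw [Complex.sub_re, Complex.sub_im]
        have : |z.im - (P i).im| ≤ h := by rw [abs_le]; constructor <;> linarith
        linarith
      · exact ⟨show z.im ≤ (P i).im by have : z.im < (P i).im - h := him; linarith, ball_subset_closedBall hball⟩
  have hyb₀ : JoinedIn (J \ Cut) ((s j : ℂ) * hexCenter y - τj) b₀ := (hjoin.mono hXCut).symm.trans hjs
  -- the reach disc
  have hptY : ∀ p : ℂ, dist p ((s j : ℂ) * hexCenter y - τj) ≤ 60 * s j → p ∈ J ∧ p ∉ Y := by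
    intro p hp
    obtain ⟨hJ, hF, hB⟩ := hpt y hyend p hp
    refine ⟨hJ, ?_⟩
    rintro (hF' | hZ)
    · exact hF hF'
    · obtain ⟨i, hi⟩ := mem_iUnion.1 hZ
      exact absurd hi (not_lt.2 (hB i))
  have hyabove : ∀ i, dist ((s j : ℂ) * hexCenter y - τj) (P i) < R₁ → (P i).im < ((s j : ℂ) * hexCenter y - τj).im :=
    fun i hi => hja i y (mem_ball.2 hi) (hπ y hy)
  have hCut' : Cut ∩ J ⊆ Y ∪ ⋃ i, ({z : ℂ | |z.re - (P i).re| ≤ ρc ∧ (P i).im - h ≤ z.im ∧ z.im ≤ (P i).im} ∪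
      ({z : ℂ | z.im < (P i).im - h} ∩ ball (P i) (R₁ - μ))) := hCut
  obtain ⟨hyE, hdisc⟩ := stub_carvedReduction_reachDisc J E Cut Y P b₀ ((s j : ℂ) * hexCenter y - τj) (s j) ρc h R₁ μ hsj h25
    h50 hρc hR₁ hsep' hjoinE hCut' hptY hyb₀ hyabove
  refine ⟨hyE, fun p hp => ?_⟩
  rcases hdisc p hp with h1 | ⟨i, hi⟩
  · exact Or.inl h1
  · exact Or.inr (mem_iUnion.2 ⟨i, hi⟩)

end Summit.CriticalPhenomena.SAWScalingLimit.Theorems.ObservableToSLE.TypeLadder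

end
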